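import Mathlib
import Summits.Ventures.HodgeRepro2.InvariantWedge

/-!
# The Jacobian determinant of the ball action is the canonical automorphy factor

Kernel annex of the blind cell `pub-hodge-repro2` (seat p2), Tier-3 hypothesis shapes of
`Hypothesis.lean`.  For `α` acting on the ball through `ballAction` (Sh79 (4.2)), write
`j(α, z) = (α · (z, 1))₃` for the third coordinate of `α` applied to the homogeneous vector of
`z` (`autFactor α z`, Shimura's automorphy factor).  This file computes the Jacobian of the ball
action EXPLICITLY and proves the classical identity

  `det J_α(z) = det α / j(α, z)³`

(`det_jacobian_eq`), so that by `InvariantWedge.lean` the wedge `q₁ ∧ q₂` of two `Γ`-invariant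
holomorphic 1-forms transforms as an automorphic form of WEIGHT 3 with character `det⁻¹`:
`q₁∧q₂ (αz) = j(α, z)³ · det(α)⁻¹ · q₁∧q₂ (z)` (`wedgeAt_ballAction_eq`), and of weight 3
and trivial character for `α ∈ SU(2,1)` (`wedgeAt_ballAction_eq_of_det_eq_one`) — the shape in
which Shimura's Thm 8.1 produces holomorphic 2-forms on `Γ\𝔹²` from automorphic forms.  Also:
the cocycle relation `j(αβ, z) = j(α, βz) · j(β, z)` (`autFactor_mul`).
-/

namespace Summit.Ventures.HodgeRepro2.ShimuraData

open Matrix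

/-- Shimura's automorphy factor `j(α, z) = (α · (z, 1))₃`. -/
def autFactor (α : Matrix (Fin 3) (Fin 3) ℂ) (z : Fin 2 → ℂ) : ℂ :=
  α.mulVec (homog z) (Fin.last 2)

/-- The automorphy factor of the identity is `1`. -/
theorem autFactor_one (z : Fin 2 → ℂ) : autFactor 1 z = 1 := by
  simp [autFactor, homog_two]

/-- The automorphy factor of `α ∈ U(2,1)` does not vanish on the ball. -/
theorem IsInU21.autFactor_ne_zero {α : Matrix (Fin 3) (Fin 3) ℂ} (hα : IsInU21 α)
    {z : Fin 2 → ℂ} (hz : z ∈ ball₂) : autFactor α z ≠ 0 :=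
  hα.mulVec_homog_last_ne_zero hz

/-- `α · (z, 1) = j(α, z) · (αz, 1)`: the projective action, with the automorphy factor as the
scalar. -/
theorem mulVec_homog_eq_autFactor_smul {α : Matrix (Fin 3) (Fin 3) ℂ} {z : Fin 2 → ℂ}
    (hD : autFactor α z ≠ 0) :
    α.mulVec (homog z) = autFactor α z • homog (ballAction α z) := by
  funext l
  refine Fin.lastCases ?_ (fun k => ?_) l
  · rw [Pi.smul_apply, homog_last, smul_eq_mul, mul_one]
    rfl
  · rw [Pi.smul_apply, homog_castSucc, smul_eq_mul]
    show _ = autFactor α z * (α.mulVec (homog z) k.castSucc / autFactor α z)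
    rw [mul_div_cancel₀ _ hD]

/-- **Cocycle relation** `j(αβ, z) = j(α, βz) · j(β, z)` (for `j(β, z) ≠ 0`). -/
theorem autFactor_mul {α β : Matrix (Fin 3) (Fin 3) ℂ} {z : Fin 2 → ℂ}
    (hβ : autFactor β z ≠ 0) :
    autFactor (α * β) z = autFactor α (ballAction β z) * autFactor β z := by
  have h := mulVec_homog_eq_autFactor_smul hβ
  simp only [autFactor]
  rw [← Matrix.mulVec_mulVec, h, Matrix.mulVec_smul, Pi.smul_apply, Pi.smul_apply, smul_eq_mul,
    smul_eq_mul, homog_last, mul_one, mul_comm]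

/-- The cocycle relation for `β ∈ U(2,1)` and `z` in the ball. -/
theorem IsInU21.autFactor_mul {α β : Matrix (Fin 3) (Fin 3) ℂ} (hβ : IsInU21 β)
    {z : Fin 2 → ℂ} (hz : z ∈ ball₂) :
    autFactor (α * β) z = autFactor α (ballAction β z) * autFactor β z :=
  ShimuraData.autFactor_mul (hβ.autFactor_ne_zero hz)

/-- The homogeneous vector of `z + t e_j`. -/
theorem homog_add_smul_single (z : Fin 2 → ℂ) (t : ℂ) (j : Fin 2) :
    homog (z + t • Pi.single j 1) = homog z + t • Pi.single j.castSucc 1 := by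
  funext l
  refine Fin.lastCases ?_ (fun k => ?_) l
  · rw [homog_last, Pi.add_apply, homog_last, Pi.smul_apply,
      Pi.single_eq_of_ne (Fin.castSucc_lt_last j).ne', smul_zero, add_zero]
  · rw [homog_castSucc, Pi.add_apply, Pi.add_apply, homog_castSucc, Pi.smul_apply, Pi.smul_apply,
      Pi.single_apply, Pi.single_apply]
    simp only [Fin.castSucc_inj]

/-- Each coordinate of `α · (z + t e_j, 1)` is affine in `t`. -/
theorem mulVec_homog_add_smul_single (α : Matrix (Fin 3) (Fin 3) ℂ) (z : Fin 2 → ℂ) (t : ℂ)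
    (j : Fin 2) (i : Fin 3) :
    α.mulVec (homog (z + t • Pi.single j 1)) i = α.mulVec (homog z) i + t * α i j.castSucc := by
  rw [homog_add_smul_single, Matrix.mulVec_add, Matrix.mulVec_smul, Matrix.mulVec_single_one]
  simp [Matrix.col_apply]

/-- The directional derivative of the `i`-th coordinate of the ball action in the direction
`e_j`, as a one-variable derivative. -/
theorem hasDerivAt_ballAction_line {α : Matrix (Fin 3) (Fin 3) ℂ} {z : Fin 2 → ℂ}
    (hD : autFactor α z ≠ 0) (i j : Fin 2) :
    HasDerivAt (fun t : ℂ => ballAction α (z + t • Pi.single j 1) i)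
      ((α i.castSucc j.castSucc * autFactor α z -
        α.mulVec (homog z) i.castSucc * α (Fin.last 2) j.castSucc) / autFactor α z ^ 2) 0 := by
  have hnum : HasDerivAt (fun t : ℂ => α.mulVec (homog z) i.castSucc + t * α i.castSucc j.castSucc)
      (α i.castSucc j.castSucc) 0 := by
    simpa using ((hasDerivAt_id (0 : ℂ)).mul_const (α i.castSucc j.castSucc)).const_add
      (α.mulVec (homog z) i.castSucc)
  have hden : HasDerivAt (fun t : ℂ => α.mulVec (homog z) (Fin.last 2) + t * α (Fin.last 2) j.castSucc)
      (α (Fin.last 2) j.castSucc) 0 := by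
    simpa using ((hasDerivAt_id (0 : ℂ)).mul_const (α (Fin.last 2) j.castSucc)).const_add
      (α.mulVec (homog z) (Fin.last 2))
  have h := hnum.div hden (by simpa [autFactor] using hD)
  simp only [zero_mul, add_zero] at h
  refine h.congr_of_eventuallyEq (Filter.Eventually.of_forall fun t => ?_)
  simp only [Pi.div_apply, ballAction, mulVec_homog_add_smul_single]

/-- **Explicit Jacobian of the ball action**:
`J_α(z)ᵢⱼ = (αᵢⱼ · j(α,z) − (α·(z,1))ᵢ · α₃ⱼ) / j(α,z)²` (indices `i, j ∈ {1, 2}`). -/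
theorem jacobian_apply_eq {α : Matrix (Fin 3) (Fin 3) ℂ} (hα : IsInU21 α) {z : Fin 2 → ℂ}
    (hz : z ∈ ball₂) (i j : Fin 2) :
    jacobian α z i j = (α i.castSucc j.castSucc * autFactor α z -
        α.mulVec (homog z) i.castSucc * α (Fin.last 2) j.castSucc) / autFactor α z ^ 2 := by
  have hD := hα.autFactor_ne_zero hz
  have hdiff : DifferentiableAt ℂ (ballAction α) z := hα.differentiableAt_ballAction hz
  -- the Jacobian entry is the derivative along the line `t ↦ z + t e_j`
  have hline : HasDerivAt (fun t : ℂ => z + t • Pi.single j 1) (Pi.single j 1) 0 := by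
    simpa using ((hasDerivAt_id (0 : ℂ)).smul_const (Pi.single j (1 : ℂ))).const_add z
  have hcomp : HasDerivAt (fun t : ℂ => ballAction α (z + t • Pi.single j 1))
      (fderiv ℂ (ballAction α) z (Pi.single j 1)) 0 :=
    HasFDerivAt.comp_hasDerivAt (0 : ℂ) (l := ballAction α) (by simpa using hdiff.hasFDerivAt)
      hline
  have hcomp_i : HasDerivAt (fun t : ℂ => ballAction α (z + t • Pi.single j 1) i)
      (fderiv ℂ (ballAction α) z (Pi.single j 1) i) 0 :=
    hasDerivAt_pi.1 hcomp i
  have h := (hasDerivAt_ballAction_line hD i j).unique hcomp_i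
  rw [jacobian, ← h]

/-- **The Jacobian determinant is the canonical automorphy factor**:
`det J_α(z) = det α / j(α, z)³` for `α ∈ U(2,1)` and `z` in the ball. -/
theorem det_jacobian_eq {α : Matrix (Fin 3) (Fin 3) ℂ} (hα : IsInU21 α) {z : Fin 2 → ℂ}
    (hz : z ∈ ball₂) : (jacobian α z).det = α.det / autFactor α z ^ 3 := by
  have hD := hα.autFactor_ne_zero hz
  have hN : ∀ i : Fin 3, α.mulVec (homog z) i = α i 0 * z 0 + α i 1 * z 1 + α i 2 := by
    intro i
    simp [Matrix.mulVec, dotProduct, Fin.sum_univ_three, homog_zero, homog_one, homog_two]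
  have hD' : autFactor α z = α 2 0 * z 0 + α 2 1 * z 1 + α 2 2 := hN 2
  rw [Matrix.det_fin_two, jacobian_apply_eq hα hz, jacobian_apply_eq hα hz,
    jacobian_apply_eq hα hz, jacobian_apply_eq hα hz, Matrix.det_fin_three]
  simp only [hN, Fin.castSucc_zero, Fin.castSucc_one, show (Fin.last 2 : Fin 3) = 2 from rfl]
  rw [hD'] at hD ⊢
  field_simp
  ring

/-- **Weight-3 automorphy of the wedge**: for `α ∈ U(2,1)` and `α`-invariant `q₁, q₂`,
`q₁∧q₂ (αz) = j(α, z)³ · det(α)⁻¹ · q₁∧q₂ (z)`. -/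
theorem wedgeAt_ballAction_eq {α : Matrix (Fin 3) (Fin 3) ℂ} (hα : IsInU21 α)
    {q₁ q₂ : (Fin 2 → ℂ) → Fin 2 → ℂ} (h₁ : IsInvariantUnder α q₁) (h₂ : IsInvariantUnder α q₂)
    {z : Fin 2 → ℂ} (hz : z ∈ ball₂) :
    wedgeAt q₁ q₂ (ballAction α z) = autFactor α z ^ 3 / α.det * wedgeAt q₁ q₂ z := by
  have hD := hα.autFactor_ne_zero hz
  have hdet := hα.det_ne_zero
  rw [wedgeAt_eq_det_jacobian_mul h₁ h₂ hz, det_jacobian_eq hα hz]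
  field_simp

/-- For `α ∈ SU(2,1)`, the wedge of two `α`-invariant holomorphic 1-forms is an automorphic
form of weight 3 and trivial character: `q₁∧q₂ (αz) = j(α, z)³ · q₁∧q₂ (z)`. -/
theorem wedgeAt_ballAction_eq_of_det_eq_one {α : Matrix (Fin 3) (Fin 3) ℂ} (hα : IsInU21 α)
    (hdet : α.det = 1) {q₁ q₂ : (Fin 2 → ℂ) → Fin 2 → ℂ} (h₁ : IsInvariantUnder α q₁)
    (h₂ : IsInvariantUnder α q₂) {z : Fin 2 → ℂ} (hz : z ∈ ball₂) :
    wedgeAt q₁ q₂ (ballAction α z) = autFactor α z ^ 3 * wedgeAt q₁ q₂ z := by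
  rw [wedgeAt_ballAction_eq hα h₁ h₂ hz, hdet, div_one]

end Summit.Ventures.HodgeRepro2.ShimuraData
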